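import Summits.NavierStokesRegularity.NavierStokesRegularity.Theses.HardyPointSink
import Summits.NavierStokesRegularity.NavierStokesRegularity.Theorems.AxisymmetricSwirlRegularity
import Summits.NavierStokesRegularity.NavierStokesRegularity.Theorems.HardyPointSinkHardyEnergyBoundAxisTransfer
import Summits.NavierStokesRegularity.NavierStokesRegularity.Theorems.AxisymmetricExtremalityAxisymmetricKatoGlobalStubKatoAxisymSingularPoint
import Summits.NavierStokesRegularity.NavierStokesRegularity.Theorems.AxisymmetricExtremalityAxisymmetricKatoGlobalStubKatoLocalEnergyNearTop
import Summits.NavierStokesRegularity.NavierStokesRegularity.Theorems.AxisymmetricExtremalityAxisymmetricKatoGlobalStubOffAxisBoundedOfLocalEnergy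
import Summits.NavierStokesRegularity.NavierStokesRegularity.Theorems.AxisymmetricExtremalityAxisymmetricKatoGlobalReduction
import Literature.Analysis.FluidPDE.NSKatoToClayHolds
import Literature.Analysis.FluidPDE.NSLerayHopf
import Literature.Analysis.FluidPDE.NSLerayHopfSereginProofs
import Literature.Analysis.FluidPDE.NSLerayHopfSereginEnergyProofs
import Literature.Analysis.FluidPDE.TaoLocalisation
import Literature.Analysis.FluidPDE.EnstrophySplitting
import HarnessLib

/-!
# Route HardyPointSink — crux `HardyEnergyBound` (item stmt-NavierStokesRegularity-7979):
# the Hardy bound implies axisymmetric regularity with swirl, modulo Seregin 2020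

Support file (theorems only, `--supports stmt-NavierStokesRegularity-7979`; lead c5 of the crux
line, 2026-08-17).  It positions the crux `C2 = Theses.HardyPointSink.HardyEnergyBound` against a
REGISTERED open problem of the summit, the conjecture leaf
`Summit.NavierStokesRegularity.NavierStokesRegularity.AxisymmetricSwirlRegularity` (ns.S25: global
classical bounded-energy solutions for smooth, divergence-free, rapidly decaying AXISYMMETRIC data,
swirl allowed — open since Ladyzhenskaya 1968), modulo the printed theorem Seregin 2020 Thm 2.1
(tree named fact `Seregin2020_axisymmetricSingularPoint_typeII`, unproved in the tree):

* `hardyEnergyBound_hasGlobalKatoSolution_axisymmetric` — C2 and Seregin's theorem give a GLOBAL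
  Kato solution for every smooth, divergence-free, rapidly decaying axisymmetric datum: otherwise
  the maximal Kato solution has a singular point `(T, x_*)`
  (`AxisymmetricKatoGlobal.Registered.stub_katoAxisymSingularPoint`, p149337), with the normalised
  pressure it is suitable on the strip with local energy classes to the top
  (`…stub_katoLocalEnergyNearTop`, p149176), off the axis `x_*` is bounded near `T`
  (`…stub_offAxisBounded_of_localEnergy`, p147674), on the axis C2 at the centre `x_*`, read at the
  sink `x₀ = x_*`, is the single-centre Hardy bound of `hardyEnergyBound_axisTransfer`
  (`HardyPointSinkHardyEnergyBoundAxisTransfer.lean`) — contradiction with the singular cylinder.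
* `axisymmetricSwirlRegularity_of_hardyEnergyBound` —
  `Seregin2020_axisymmetricSingularPoint_typeII → HardyEnergyBound → AxisymmetricSwirlRegularity`
  (Kato → Clay by the PROVED fact `clay_solution_of_hasGlobalKatoSolution_holds`).
* `not_hardyEnergyBound_of_not_axisymmetricSwirlRegularity` — contrapositive: modulo Seregin 2020,
  ANY finite-time singularity of an axisymmetric Clay datum (e.g. Hou's scenario arXiv:2107.06509,
  if singular) refutes C2 — no tail analysis is needed (compare the negative lemma
  `HardyEnergyBound_false_of_TailedKatoBlowup`, p159280, which needs a `C/|x − x_*|` tail):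
  axisymmetric singular points are Type II in the scaled-energy sense, while C2 forces Type I in
  the scaled-energy sense at every point.

So, as tree theorems: `NavierStokesRegularity → C2` (`hardyEnergyBound_of_navierStokesRegularity`,
p155031) and `C2 → AxisymmetricSwirlRegularity` modulo Seregin 2020 (this file): the crux is
sandwiched between the summit and its axisymmetric sub-conjecture.

References: G. Seregin, Anal. Math. Phys. 10 (2020), Paper 46, Thm 2.1 [Seregin2020];
G. Koch, N. Nadirashvili, G. Seregin, V. Šverák, Acta Math. 203 (2009), §5–6 [KNSS2009];
T. Kato, Math. Z. 187 (1984), Thms 1, 4; P. G. Lemarié-Rieusset, *The Navier–Stokes Problem in the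
21st Century*, CRC 2016, Prop. 12.3, Thm 15.1 [Kato1984, LemarieRieusset2016].
-/

noncomputable section

-- the summit and its single sub-problem share the name (CONVENTIONS §1), as in every Theorems file
set_option linter.dupNamespace false

open Set MeasureTheory Filter Topology Function Metric Module Literature.Analysis.FluidPDE
open scoped ENNReal NNReal

namespace Summit.NavierStokesRegularity.NavierStokesRegularity.Theorems

open AxisymmetricKatoGlobal

/-! ### C2 ⇒ axisymmetric regularity with swirl (modulo Seregin 2020) -/

/-- **A smooth, divergence-free, rapidly decaying axisymmetric datum has a global Kato solution,
given `HardyEnergyBound` and Seregin 2020, Thm 2.1.**  By contradiction: without a global Kato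
solution the maximal Kato solution is smooth and axisymmetric inside and singular at some
`(T, x_*)` (`Registered.stub_katoAxisymSingularPoint`); with the normalised pressure it is suitable
on the strip with local energy classes to the top (`Registered.stub_katoLocalEnergyNearTop`); off
the axis `x_*` is bounded near `T` (`Registered.stub_offAxisBounded_of_localEnergy`); on the axis
`HardyEnergyBound` at the centre `x_*`, read at the sink `x₀ = x_*`, is the single-centre Hardy
bound of `hardyEnergyBound_axisTransfer` — so `x_*` is bounded near `T` in both cases,
contradicting the singular cylinder. [cite: Seregin2020, Thm 2.1] -/
theorem hardyEnergyBound_hasGlobalKatoSolution_axisymmetric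
    (hSer : Seregin2020_axisymmetricSingularPoint_typeII)
    (hC2 : Theses.HardyPointSink.HardyEnergyBound) :
    ∀ ν : ℝ, 0 < ν → ∀ u₀ : (EuclideanSpace ℝ (Fin 3)) → (EuclideanSpace ℝ (Fin 3)), ContDiff ℝ (⊤ : ℕ∞) u₀ → VectorCalculus.IsDivFree u₀ →
      HasRapidSpatialDecay u₀ → IsAxisymmetric u₀ → HasGlobalKatoSolution ν u₀ := by
  intro ν hν u₀ hsm hdiv hdec hax
  classical
  /- ### the datum: `L³`, weakly divergence free (as in `hardyTypeIExtraction_proof`) -/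
  have hdivW : NSWave0.IsDivFree u₀ := fun x => hdiv x
  have hHk : ∀ n : ℕ, ∫⁻ x, ‖iteratedFDeriv ℝ n u₀ x‖ₑ ^ 2 < ⊤ :=
    hdec.lintegral_enorm_iteratedFDeriv_sq_lt_top
  have hmeas0 : AEStronglyMeasurable u₀ volume := hsm.continuous.aestronglyMeasurable
  have hL2 : ∫⁻ x, ‖u₀ x‖ₑ ^ 2 < ⊤ := by
    refine lt_of_le_of_lt (le_of_eq (lintegral_congr fun x => ?_)) (hHk 0)
    rw [← ofReal_norm, ← ofReal_norm, norm_iteratedFDeriv_zero]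
  have hu2 : MemLp u₀ 2 volume := ⟨hmeas0, eLpNorm_two_lt_top_of_lintegral_enorm_sq_lt_top hL2⟩
  obtain ⟨C₀, hC₀⟩ := hdec 0 0
  have hbd0 : ∀ x, ‖u₀ x‖ ≤ C₀ := fun x => by
    have h := hC₀ x
    rwa [pow_zero, one_mul, norm_iteratedFDeriv_zero] at h
  have hu3 : MemLp u₀ 3 volume := by
    refine ⟨hmeas0, ?_⟩
    have h3 : eLpNorm u₀ 3 volume ^ 3 ≤ eLpNorm u₀ ⊤ volume * eLpNorm u₀ 2 volume ^ 2 :=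
      eLpNorm_three_pow_le hmeas0
    have htop : eLpNorm u₀ ⊤ volume ≤ ENNReal.ofReal C₀ := eLpNorm_top_le_of_bound hbd0
    have hfin : eLpNorm u₀ ⊤ volume * eLpNorm u₀ 2 volume ^ 2 < ⊤ :=
      ENNReal.mul_lt_top (htop.trans_lt ENNReal.ofReal_lt_top)
        (ENNReal.pow_lt_top hu2.eLpNorm_lt_top)
    by_contra hnot
    rw [not_lt, top_le_iff] at hnot
    rw [hnot, ENNReal.top_pow (by norm_num)] at h3
    exact absurd (h3.trans_lt hfin) (lt_irrefl _)
  have hwdiv : IsWeaklyDivFree u₀ :=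
    VectorCalculus.IsDivFree.isWeaklyDivFree_holds hdiv (hsm.of_le (mod_cast le_top))
  /- ### by contradiction: the singular point of the maximal Kato solution -/
  by_contra hng
  obtain ⟨T, hT, xs, u, hK, hsmU, haxi, hsing⟩ :=
    Registered.stub_katoAxisymSingularPoint ν hν u₀ hu3 hwdiv hax hng
  obtain ⟨p, hpax, hsw, hloc⟩ := Registered.stub_katoLocalEnergyNearTop ν hν T hT u₀ u hK hsmU haxi
  have hbdd : IsBoundedNearTop u T xs := by
    by_cases h0 : cylRadius xs = 0
    · -- on the axis: the local Hardy bound of C2 at the centre `xs`, read at the sink `x₀ = xs`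
      obtain ⟨r₀, hr₀, K, hKb⟩ := hC2 ν hν u₀ hsm hdivW hdec T u hT hK xs
      refine hardyEnergyBound_axisTransfer hSer ν hν T hT u p hsmU haxi hpax hsw hloc xs h0
        ⟨r₀, hr₀, K, fun t ht ht0 => ?_⟩
      exact hKb xs (mem_ball_self hr₀) t ⟨ht0.le, ht.2⟩ ht.1
    · -- off the axis: landed stub 2b'
      exact Registered.stub_offAxisBounded_of_localEnergy ν hν T hT u p hsmU haxi hsw hloc xs h0
  obtain ⟨r, hr, M, hbd⟩ := hbdd
  -- contradiction with the singularity of `(T, xs)` at radius `r`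
  exact absurd (hsing r hr) (Registered.eLpNorm_parabolicCylinder_lt_top_of_forall_le hbd).ne

/-- **`HardyEnergyBound` implies the axisymmetric-with-swirl regularity conjecture, modulo
Seregin 2020, Thm 2.1**: `Seregin2020_axisymmetricSingularPoint_typeII → HardyEnergyBound →
AxisymmetricSwirlRegularity` (ns.S25, the registered conjecture leaf of the summit).  The global
Kato solution of `hardyEnergyBound_hasGlobalKatoSolution_axisymmetric` is converted to a global
classical bounded-energy solution by the PROVED fact `clay_solution_of_hasGlobalKatoSolution_holds`
(Kato 1984 Thm 4 / Lemarié-Rieusset 2016 Prop. 12.3) and `isNavierStokesSolution_and_smooth_iff`.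
So the crux C2 of route HardyPointSink is at least as strong as axisymmetric regularity with swirl
(given a printed theorem), and `NavierStokesRegularity → C2` (p155031) bounds it from above.
[cite: Seregin2020, Thm 2.1] -/
theorem axisymmetricSwirlRegularity_of_hardyEnergyBound :
    Literature.Analysis.FluidPDE.Seregin2020_axisymmetricSingularPoint_typeII →
    Summit.NavierStokesRegularity.NavierStokesRegularity.Theses.HardyPointSink.HardyEnergyBound →
    Summit.NavierStokesRegularity.NavierStokesRegularity.AxisymmetricSwirlRegularity := by
  intro hSer hC2 ν hν u₀ hsm hdiv hdec hax
  have hdivW : NSWave0.IsDivFree u₀ := fun x => hdiv x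
  have hGK : HasGlobalKatoSolution ν u₀ :=
    hardyEnergyBound_hasGlobalKatoSolution_axisymmetric hSer hC2 ν hν u₀ hsm hdiv hdec hax
  obtain ⟨u, p, hu, hp, hns, hE⟩ :=
    clay_solution_of_hasGlobalKatoSolution_holds ν hν u₀ hsm hdivW hdec hGK
  obtain ⟨hcl, h0⟩ := isNavierStokesSolution_and_smooth_iff.1 ⟨hns, hu, hp⟩
  exact ⟨u, p, hcl, h0, hE⟩

/-- **Contrapositive: modulo Seregin 2020, any failure of axisymmetric regularity with swirl —
i.e. any finite-time singularity of a smooth, divergence-free, rapidly decaying axisymmetric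
datum (Hou's scenario, arXiv:2107.06509, if singular) — refutes `HardyEnergyBound`.**  No tail
analysis is needed: axisymmetric singular points are Type II in the scaled-energy sense, while
the local Hardy bound forces Type I in the scaled-energy sense at every point.
[cite: Seregin2020, Thm 2.1] -/
theorem not_hardyEnergyBound_of_not_axisymmetricSwirlRegularity
    (hSer : Seregin2020_axisymmetricSingularPoint_typeII)
    (hAX : ¬ Summit.NavierStokesRegularity.NavierStokesRegularity.AxisymmetricSwirlRegularity) :
    ¬ Theses.HardyPointSink.HardyEnergyBound := fun hC2 =>
  hAX (axisymmetricSwirlRegularity_of_hardyEnergyBound hSer hC2)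

end Summit.NavierStokesRegularity.NavierStokesRegularity.Theorems

end
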